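import Summits.ResolutionOfSingularities.ResolutionOfSingularities.Theorems.EquisingularLiftEquisingularLiftNatReachNecessity
import HarnessLib

/-!
# [OURS · L1 W4.5(b) · EL♮] T-REACH-NECESSITY (2): piece A `ReachIsolatedAt` ⇒ the LAST touch over `x` has NON-PRINCIPAL trace — any `n`
# (crux `EquisingularLiftNat` = stmt-ResolutionOfSingularities-20038; K-∀n / K5-BMY necessity lane on the registered refuter target `stub_elnat_ge_four_reach`)

HONEST FRAMING. OURS (cell res-hironaka, crux chain w45b, slot W4.5(b)); NOT a statement of any manuscript; replaces the role of
NOTHING in the manuscript; AI-written, AI review is weaker than expert review. Helper `--supports stmt-ResolutionOfSingularities-20038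
--as helper`. Companion of `…NatReachNecessity` (p528457: `firstProgressTouch_of_reachIsolatedAt`, the FIRST progress touch); here the LAST touch
(`exists_useful_touch_of_horizChain_of_regularOver` + `not_isPrincipal_trace_of_usefulTouch` p518228 + `isIrreducible_closure_and_not_subset_of_horizChain`
p520241), for piece A of res-L1-w45b-strat-1's stage cut (`…NatStageCut` p525046).

* `usefulTouchNonprincipal_of_reachIsolatedAt` — `ReachIsolatedAt p k n H ι` ⇒ for every non-regular `h ∈ H` with INFINITE closure, over A's `(O, π)`
  and every `φ, Y`: a stage of the horizontal E1-closure (closure `Y₁` irreducible, `⊄ supp C`), `x₁ ∈ Y₁` over `x` with a non-regular point `w` over it,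
  an admissible step through `x₁` after which every point over `x` is regular, and `(C·𝒪_{V(closure Y₁)})_w` NOT principal.
-/

set_option linter.dupNamespace false -- mandated namespace `Summit.<Summit>.<Problem>` of this single-conjunct summit
set_option linter.overlappingInstances false -- item signatures carry `[IsDomain O] [IsDiscreteValuationRing O]`

open CategoryTheory AlgebraicGeometry TopologicalSpace Topology
open Literature.AlgebraicGeometry.Resolution
open AlgebraicGeometry.Scheme.IdealSheafData
open Summit.ResolutionOfSingularities.ResolutionOfSingularities.Theses.EquisingularLift.Split
open Summit.ResolutionOfSingularities.ResolutionOfSingularities.Cruxes.EquisingularLift.StrataSplit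
open Summit.ResolutionOfSingularities.ResolutionOfSingularities.Theorems.EquisingularLift
open Summit.ResolutionOfSingularities.ResolutionOfSingularities.Theorems.EquisingularLiftNatStageCut

namespace Summit.ResolutionOfSingularities.ResolutionOfSingularities.Cruxes.EquisingularLiftNat.Sections

/-! ## THE OBJECT for piece A, last-touch form -/

/-- **[OURS · L1 W4.5(b)] PIECE A ⇒ A USEFUL TOUCH WITH NON-PRINCIPAL TRACE over every non-regular point of infinite closure.** If
`ReachIsolatedAt p k n H ι`, `ι` a closed immersion of the integral `H`, and `h ∈ H` has NON-regular local ring and INFINITE closure, then over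
A's `(O, π)` and every `φ, Y`, with `x := (ι ≫ Proj.map φ) h`: there are a stage `(X₁, σ₁, Y₁)` of the horizontal E1-closure of `(ℙⁿ_O, 𝟙, Y)` with
closure `Y₁` irreducible, `x₁ ∈ Y₁` over `x` with a non-regular point `w` of `V(closure Y₁)` over it, and an admissible step `Bl_C` (regular, `O`-flat,
off the generic point, E1) through `x₁`, `closure Y₁ ⊄ supp C`, after which EVERY point over `x` is regular — the LAST touch over `x` — whose trace
`(C·𝒪_{V(closure Y₁)})_w` is NOT principal (`exists_useful_touch_of_horizChain_of_regularOver` + `not_isPrincipal_trace_of_usefulTouch` p518228; the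
stage of piece A is regular over `x` by `isRegularLocalRing_of_finite_singSet_of_infinite_closure`). [folklore] -/
theorem usefulTouchNonprincipal_of_reachIsolatedAt {p : ℕ} {k : Type} [Field k] [CharP k p] [IsAlgClosed k] {n : ℕ}
    {H : AlgebraicGeometry.Scheme.{0}} {ι : H ⟶ (Literature.AlgebraicGeometry.Motives.projectiveSpace n k).left}
    (hA : ReachIsolatedAt p k n H ι) (hι : AlgebraicGeometry.IsClosedImmersion ι) (hH : AlgebraicGeometry.IsIntegral H)
    (h : H) (hreg : ¬ IsRegularLocalRing (H.presheaf.stalk h)) (hinf : (closure ({h} : Set H)).Infinite) :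
    ∃ (O : Type) (_ : CommRing O) (_ : IsDomain O) (_ : IsDiscreteValuationRing O) (_ : CharZero O) (π : O →+* k), Function.Surjective π ∧ (letI := MvPolynomial.gradedAlgebra (σ := Fin (n + 1)) (R := O); letI := MvPolynomial.gradedAlgebra (σ := Fin (n + 1)) (R := k); ∀ (φ : MvPolynomial.homogeneousSubmodule (Fin (n + 1)) O →+*ᵍ MvPolynomial.homogeneousSubmodule (Fin (n + 1)) k) (hφ' : HomogeneousIdeal.irrelevant (MvPolynomial.homogeneousSubmodule (Fin (n + 1)) k) ≤ (HomogeneousIdeal.irrelevant (MvPolynomial.homogeneousSubmodule (Fin (n + 1)) O)).map φ), (∀ s, φ s = MvPolynomial.map π s) → ∀ Y : Set (AlgebraicGeometry.Proj (MvPolynomial.homogeneousSubmodule (Fin (n + 1)) O)), Y = Set.range (CategoryTheory.CategoryStruct.comp ι (AlgebraicGeometry.Proj.map φ hφ') : H ⟶ (AlgebraicGeometry.Proj (MvPolynomial.homogeneousSubmodule (Fin (n + 1)) O))) → ∃ (X₁ : AlgebraicGeometry.Scheme.{0}) (σ₁ : X₁ ⟶ (AlgebraicGeometry.Proj (MvPolynomial.homogeneousSubmodule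 (Fin (n + 1)) O))) (Y₁ : Set X₁), (∀ Q : (∀ X' : AlgebraicGeometry.Scheme.{0}, (X' ⟶ (AlgebraicGeometry.Proj (MvPolynomial.homogeneousSubmodule (Fin (n + 1)) O))) → Set X' → Prop), Q (AlgebraicGeometry.Proj (MvPolynomial.homogeneousSubmodule (Fin (n + 1)) O)) (CategoryTheory.CategoryStruct.id _) Y → (∀ (X' X'' : AlgebraicGeometry.Scheme.{0}) (σ' : X' ⟶ (AlgebraicGeometry.Proj (MvPolynomial.homogeneousSubmodule (Fin (n + 1)) O))) (Y' : Set X') (C : X'.IdealSheafData) (τ : X'' ⟶ X'), Q X' σ' Y' → Literature.AlgebraicGeometry.Resolution.IsBlowup τ C → Literature.AlgebraicGeometry.Resolution.Scheme.IsRegular C.subscheme → AlgebraicGeometry.Flat (CategoryTheory.CategoryStruct.comp C.subschemeι (CategoryTheory.CategoryStruct.comp σ' (CategoryTheory.CategoryStruct.comp (AlgebraicGeometry.Proj.toSpecZero (MvPolynomial.homogeneousSubmodule (Fin (n + 1)) O)) (AlgebraicGeometry.Spec.map (CommRingCat.ofHom (algebraMap O (MvPolynomial.homogeneousSubmodule (Fin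 (n + 1)) O 0))))))) → σ' '' (C.support : Set X') ⊆ {x | ¬ IsGenericPoint x Y} → (C.support : Set X') ∩ (CategoryTheory.CategoryStruct.comp σ' (CategoryTheory.CategoryStruct.comp (AlgebraicGeometry.Proj.toSpecZero (MvPolynomial.homogeneousSubmodule (Fin (n + 1)) O)) (AlgebraicGeometry.Spec.map (CommRingCat.ofHom (algebraMap O (MvPolynomial.homogeneousSubmodule (Fin (n + 1)) O 0)))))) ⁻¹' {IsLocalRing.closedPoint O} ⊆ Y' → Q X'' (CategoryTheory.CategoryStruct.comp τ σ') (closure (τ ⁻¹' (Y' \ (C.support : Set X'))))) → Q X₁ σ₁ Y₁) ∧ IsIrreducible (closure Y₁) ∧ ∃ (x₁ : X₁) (w : ↥(AlgebraicGeometry.Scheme.IdealSheafData.vanishingIdeal (⟨closure Y₁, isClosed_closure⟩ : TopologicalSpace.Closeds X₁)).subscheme) (C : X₁.IdealSheafData) (X₂ : AlgebraicGeometry.Scheme.{0}) (τ : X₂ ⟶ X₁), x₁ ∈ Y₁ ∧ σ₁ x₁ = ((CategoryTheory.CategoryStruct.comp ι (AlgebraicGeometry.Proj.map φ hφ') : H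 ⟶ (AlgebraicGeometry.Proj (MvPolynomial.homogeneousSubmodule (Fin (n + 1)) O))) h) ∧ (AlgebraicGeometry.Scheme.IdealSheafData.vanishingIdeal (⟨closure Y₁, isClosed_closure⟩ : TopologicalSpace.Closeds X₁)).subschemeι w = x₁ ∧ ¬ IsRegularLocalRing ((AlgebraicGeometry.Scheme.IdealSheafData.vanishingIdeal (⟨closure Y₁, isClosed_closure⟩ : TopologicalSpace.Closeds X₁)).subscheme.presheaf.stalk w) ∧ Literature.AlgebraicGeometry.Resolution.IsBlowup τ C ∧ Literature.AlgebraicGeometry.Resolution.Scheme.IsRegular C.subscheme ∧ AlgebraicGeometry.Flat (CategoryTheory.CategoryStruct.comp C.subschemeι (CategoryTheory.CategoryStruct.comp σ₁ (CategoryTheory.CategoryStruct.comp (AlgebraicGeometry.Proj.toSpecZero (MvPolynomial.homogeneousSubmodule (Fin (n + 1)) O)) (AlgebraicGeometry.Spec.map (CommRingCat.ofHom (algebraMap O (MvPolynomial.homogeneousSubmodule (Fin (n + 1)) O 0))))))) ∧ σ₁ '' (C.support : Set X₁) ⊆ {x | ¬ IsGenericPoint x Y} ∧ (C.support : Set X₁)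 ∩ (CategoryTheory.CategoryStruct.comp σ₁ (CategoryTheory.CategoryStruct.comp (AlgebraicGeometry.Proj.toSpecZero (MvPolynomial.homogeneousSubmodule (Fin (n + 1)) O)) (AlgebraicGeometry.Spec.map (CommRingCat.ofHom (algebraMap O (MvPolynomial.homogeneousSubmodule (Fin (n + 1)) O 0)))))) ⁻¹' {IsLocalRing.closedPoint O} ⊆ Y₁ ∧ x₁ ∈ (C.support : Set X₁) ∧ ¬ closure Y₁ ⊆ (C.support : Set X₁) ∧ (∀ w' : ↥(AlgebraicGeometry.Scheme.IdealSheafData.vanishingIdeal (⟨closure (closure (τ ⁻¹' (Y₁ \ (C.support : Set X₁)))), isClosed_closure⟩ : TopologicalSpace.Closeds X₂)).subscheme, (CategoryTheory.CategoryStruct.comp τ σ₁) ((AlgebraicGeometry.Scheme.IdealSheafData.vanishingIdeal (⟨closure (closure (τ ⁻¹' (Y₁ \ (C.support : Set X₁)))), isClosed_closure⟩ : TopologicalSpace.Closeds X₂)).subschemeι w') = ((CategoryTheory.CategoryStruct.comp ι (AlgebraicGeometry.Proj.map φ hφ') : H ⟶ (AlgebraicGeometry.Proj (MvPolynomial.homogeneousSubmodule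 (Fin (n + 1)) O))) h) → IsRegularLocalRing ((AlgebraicGeometry.Scheme.IdealSheafData.vanishingIdeal (⟨closure (closure (τ ⁻¹' (Y₁ \ (C.support : Set X₁)))), isClosed_closure⟩ : TopologicalSpace.Closeds X₂)).subscheme.presheaf.stalk w')) ∧ ¬ (stalkIdeal (C.comap (AlgebraicGeometry.Scheme.IdealSheafData.vanishingIdeal (⟨closure Y₁, isClosed_closure⟩ : TopologicalSpace.Closeds X₁)).subschemeι) w).IsPrincipal) := by
  obtain ⟨O, i1, i2, i3, i4, i5, π, hπ, h'⟩ := hA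
  refine ⟨O, i1, i2, i3, i4, π, hπ, ?_⟩
  letI := MvPolynomial.gradedAlgebra (σ := Fin (n + 1)) (R := O)
  letI := MvPolynomial.gradedAlgebra (σ := Fin (n + 1)) (R := k)
  intro φ hφ' hφ Y hY
  haveI := hH
  obtain ⟨X₁, σ₁, S₁, hreach, hfin, -⟩ := h' φ hφ' hφ Y hY
  obtain ⟨-, hprop⟩ := stub_projectiveAmbientSmoothProper O n
  haveI : IsProper (CategoryTheory.CategoryStruct.comp (AlgebraicGeometry.Proj.toSpecZero (MvPolynomial.homogeneousSubmodule (Fin (n + 1)) O)) (AlgebraicGeometry.Spec.map (CommRingCat.ofHom (algebraMap O (MvPolynomial.homogeneousSubmodule (Fin (n + 1)) O 0))))) := hprop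
  haveI : IsNoetherianRing (CommRingCat.of O) := inferInstanceAs (IsNoetherianRing O)
  haveI : IsLocallyNoetherian (AlgebraicGeometry.Proj (MvPolynomial.homogeneousSubmodule (Fin (n + 1)) O)) := LocallyOfFiniteType.isLocallyNoetherian (CategoryTheory.CategoryStruct.comp (AlgebraicGeometry.Proj.toSpecZero (MvPolynomial.homogeneousSubmodule (Fin (n + 1)) O)) (AlgebraicGeometry.Spec.map (CommRingCat.ofHom (algebraMap O (MvPolynomial.homogeneousSubmodule (Fin (n + 1)) O 0)))))
  set g : Proj (MvPolynomial.homogeneousSubmodule (Fin (n + 1)) k) ⟶ (AlgebraicGeometry.Proj (MvPolynomial.homogeneousSubmodule (Fin (n + 1)) O)) := Proj.map φ hφ' with hg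
  have hP := ProjectiveAmbientFibre.isPullback_projMap π φ hφ hπ hφ'
  haveI : IsClosedImmersion (Spec.map (CommRingCat.ofHom π)) := IsClosedImmersion.spec_of_surjective _ hπ
  haveI hgci : IsClosedImmersion g := MorphismProperty.IsStableUnderBaseChange.of_isPullback hP.flip inferInstance
  let ι' : H ⟶ Proj (MvPolynomial.homogeneousSubmodule (Fin (n + 1)) k) := ι
  haveI : IsClosedImmersion ι' := hι
  have hYcl : IsClosed Y := by rw [hY]; exact (ι' ≫ g).isClosedEmbedding.isClosed_range
  have hξ : IsGenericPoint ((ι' ≫ g) (genericPoint H)) Y := by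
    have h1 := (genericPoint_spec H).image (ι' ≫ g).base.hom.continuous
    rw [Set.image_univ] at h1
    have h2 : closure (Set.range ⇑(ι' ≫ g)) = Y := by
      have e : Set.range ⇑(ι' ≫ g) = Y := hY.symm
      rw [e]; exact hYcl.closure_eq
    rw [h2] at h1
    exact h1
  have hci := @IsClosedImmersion.comp _ _ _ ι _ hι hgci
  have hx := @exists_vanishingIdeal_witness_of_not_isRegularLocalRing _ _ _ hci inferInstance _ hreg
  have hpropσ : IsProper σ₁ :=
    (hReach_induction (fun X' σ' _ => IsLocallyNoetherian X' ∧ IsProper σ')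
      ⟨inferInstance, (inferInstance : IsProper (CategoryTheory.CategoryStruct.id (AlgebraicGeometry.Proj (MvPolynomial.homogeneousSubmodule (Fin (n + 1)) O))))⟩
      (fun X' X'' σ' Y' C τ hQ hbl _ _ _ _ => by
        obtain ⟨hN, hP'⟩ := hQ
        haveI := hN
        haveI := hP'
        haveI : IsProper τ := hbl.isProper
        haveI : IsLocallyNoetherian X'' := LocallyOfFiniteType.isLocallyNoetherian τ
        exact ⟨inferInstance, inferInstance⟩) hreach).2
  have hxinf : (closure ({(ι' ≫ g) h} : Set (AlgebraicGeometry.Proj (MvPolynomial.homogeneousSubmodule (Fin (n + 1)) O)))).Infinite :=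
    infinite_closure_of_injective (ι' ≫ g).continuous (ι' ≫ g).isClosedEmbedding.injective h hinf
  have hregx : ∀ w : ↥(AlgebraicGeometry.Scheme.IdealSheafData.vanishingIdeal (⟨closure S₁, isClosed_closure⟩ : TopologicalSpace.Closeds X₁)).subscheme,
      σ₁ ((AlgebraicGeometry.Scheme.IdealSheafData.vanishingIdeal (⟨closure S₁, isClosed_closure⟩ : TopologicalSpace.Closeds X₁)).subschemeι w) = (ι' ≫ g) h →
      IsRegularLocalRing ((AlgebraicGeometry.Scheme.IdealSheafData.vanishingIdeal (⟨closure S₁, isClosed_closure⟩ : TopologicalSpace.Closeds X₁)).subscheme.presheaf.stalk w) := by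
    intro w hw
    haveI := hpropσ
    refine isRegularLocalRing_of_finite_singSet_of_infinite_closure S₁ hfin w ?_
    refine infinite_closure_of_isClosedMap
      (CategoryTheory.CategoryStruct.comp (AlgebraicGeometry.Scheme.IdealSheafData.vanishingIdeal (⟨closure S₁, isClosed_closure⟩ : TopologicalSpace.Closeds X₁)).subschemeι σ₁).continuous
      (CategoryTheory.CategoryStruct.comp (AlgebraicGeometry.Scheme.IdealSheafData.vanishingIdeal (⟨closure S₁, isClosed_closure⟩ : TopologicalSpace.Closeds X₁)).subschemeι σ₁).isClosedMap w ?_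
    rw [Scheme.Hom.comp_apply, hw]
    exact hxinf
  subst hY
  obtain ⟨X₂, σ₂, Y₂, hhr, x₁, hx₁Y, hx₁x, ⟨w, hw, hwreg⟩, C, X₃, τ, hbl, hC, hflat, hgen, hE1, hx₁C, hall⟩ :=
    exists_useful_touch_of_horizChain_of_regularOver (CategoryTheory.CategoryStruct.comp (AlgebraicGeometry.Proj.toSpecZero (MvPolynomial.homogeneousSubmodule (Fin (n + 1)) O)) (AlgebraicGeometry.Spec.map (CommRingCat.ofHom (algebraMap O (MvPolynomial.homogeneousSubmodule (Fin (n + 1)) O 0)))))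
      (Set.range (CategoryTheory.CategoryStruct.comp ι (AlgebraicGeometry.Proj.map φ hφ') : H ⟶ (AlgebraicGeometry.Proj (MvPolynomial.homogeneousSubmodule (Fin (n + 1)) O)))) (Set.mem_range_self h) hx hreach hregx
  obtain ⟨hirr₁, hYC⟩ := isIrreducible_closure_and_not_subset_of_horizChain (CategoryTheory.CategoryStruct.comp (AlgebraicGeometry.Proj.toSpecZero (MvPolynomial.homogeneousSubmodule (Fin (n + 1)) O)) (AlgebraicGeometry.Spec.map (CommRingCat.ofHom (algebraMap O (MvPolynomial.homogeneousSubmodule (Fin (n + 1)) O 0))))) _ hξ hhr C hgen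
  haveI : IsLocallyNoetherian X₂ :=
    (hReach_induction (q := (CategoryTheory.CategoryStruct.comp (AlgebraicGeometry.Proj.toSpecZero (MvPolynomial.homogeneousSubmodule (Fin (n + 1)) O)) (AlgebraicGeometry.Spec.map (CommRingCat.ofHom (algebraMap O (MvPolynomial.homogeneousSubmodule (Fin (n + 1)) O 0)))))) (Y := Set.range (CategoryTheory.CategoryStruct.comp ι (AlgebraicGeometry.Proj.map φ hφ') : H ⟶ (AlgebraicGeometry.Proj (MvPolynomial.homogeneousSubmodule (Fin (n + 1)) O))))
      (X₀ := (AlgebraicGeometry.Proj (MvPolynomial.homogeneousSubmodule (Fin (n + 1)) O))) (σ₀ := CategoryTheory.CategoryStruct.id _) (S₀ := Set.range (CategoryTheory.CategoryStruct.comp ι (AlgebraicGeometry.Proj.map φ hφ') : H ⟶ (AlgebraicGeometry.Proj (MvPolynomial.homogeneousSubmodule (Fin (n + 1)) O))))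
      (fun X' _ _ => IsLocallyNoetherian X') inferInstance
      (fun X' X'' σ' Y' C' τ' hN hbl' _ _ _ _ => by
        haveI := hN
        haveI : IsProper τ' := hbl'.isProper
        exact LocallyOfFiniteType.isLocallyNoetherian τ') hhr)
  refine ⟨X₂, σ₂, Y₂, hhr, hirr₁, x₁, w, C, X₃, τ, hx₁Y, hx₁x, hw, hwreg, hbl, hC, hflat, hgen, hE1, hx₁C, hYC, hall, ?_⟩
  exact not_isPrincipal_trace_of_usefulTouch σ₂ _ Y₂ C τ hbl hirr₁ hYC w (by rw [hw, hx₁x]) hwreg hall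

end Summit.ResolutionOfSingularities.ResolutionOfSingularities.Cruxes.EquisingularLiftNat.Sections
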